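import Summits.AnomalousDissipation.AnomalousDissipation.Theorems.CoherentFractionInvariantExtremeClimatesPlanar.Negative.OrbitStates
import Literature.Analysis.FluidPDE.CylindricalTrajectory
import HarnessLib

/-!
# Stationarity of the orbit climate (negative lane of
# `CoherentFraction.InvariantExtremeClimatesPlanar`, stmt-AnomalousDissipation-28074, block B)

The orbit climate `μ = orb_* Haar(T²)` of the crossed-shear root is an invariant climate of the
route's class `C̄(m, R₀)`, `m = c_K e₁`: for every horizontal `h` (`h ⊥ e₁`) and every cylindrical
test functional `Φ`,
`∫ [(f_K, Φ'(v)) + (v, ((m + h)·∇)Φ'(v)) + b(v, v, Φ'(v))] dμ(v) = 0`.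
The `m`-part vanishes pointwise on the orbit (every translate is a root), and the `h`-part is
`-(d/dt)|₀ ∫_{T²} Φ(orb(s + t h̄)) ds = 0` by translation invariance of Haar measure. [folklore]
-/

noncomputable section

set_option linter.dupNamespace false

namespace Summit.AnomalousDissipation.AnomalousDissipation.Theorems.CrossedShearOrbit

open Real MeasureTheory Filter Topology Set
open scoped InnerProductSpace ENNReal
open Literature.Analysis.FunctionSpaces Literature.Analysis.FunctionSpaces.Torus Literature.Analysis.FluidPDE
open Literature.Analysis.FluidPDE.Torus
open Summit.AnomalousDissipation.AnomalousDissipation.Theorems.CrossedShearRoot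

local notation "𝕋³" => UnitAddTorus (Fin 3)
local notation "𝕋²" => UnitAddTorus (Fin 2)
local notation "E³" => EuclideanSpace ℝ (Fin 3)
local notation "E²" => EuclideanSpace ℝ (Fin 2)

/-! ## The route's tested generator and its climate class -/

/-- The drift pairing `(u, (e·∇)Φ'(u))`. [folklore] -/
def driftTerm (e : E³) (Φ : CylindricalTest (Fin 3)) (u : energySpace (Fin 3)) : ℝ :=
  ∫ x, ⟪((u : Lp E³ 2 (volume : Measure 𝕋³)) : 𝕋³ → E³) x, Torus.fderiv (Φ.grad u) x e⟫_ℝ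

/-- The route's tested generator `(f_K, Φ'(u)) + (u, ((m+h)·∇)Φ'(u)) + b(u,u,Φ'(u))`, the integrand of
the invariant-climate class of `CoherentFraction.InvariantExtremeClimatesPlanar`. [folklore] -/
def routeIntegrand (m h : E³) (Φ : CylindricalTest (Fin 3)) (u : energySpace (Fin 3)) : ℝ :=
  (∫ x, ⟪fK x, Φ.grad u x⟫_ℝ) + driftTerm (m + h) Φ u +
    inertialPairing (u : Lp E³ 2 (volume : Measure 𝕋³)) (Φ.grad u)

/-- The invariant-climate class `C̄(m, R)` of the route (the binder of
`CoherentFraction.InvariantExtremeClimatesPlanar`): probability measures on `H` with enstrophy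
`≤ R` a.e., stationary for the drift–Euler generator with every horizontal Galilean drift `m + h`,
`h ⊥ e₁`, against all cylindrical test functionals. [folklore] -/
def climateClass (m : E³) (R : ℝ) : Set (Measure (energySpace (Fin 3))) :=
  {ρ | IsProbabilityMeasure ρ ∧
    (∀ᵐ (v : ↥(energySpace (Fin 3))) ∂ρ,
      eGradNormSq ((v : Lp E³ 2 (volume : Measure 𝕋³)) : 𝕋³ → E³) ≤ ENNReal.ofReal R) ∧
    (∀ h : E³, ⟪h, EuclideanSpace.single (1 : Fin 3) (1 : ℝ)⟫_ℝ = 0 →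
      ∀ Φ : CylindricalTest (Fin 3), ∫ v, routeIntegrand m h Φ v ∂ρ = 0)}

/-! ## Algebra and continuity of the drift pairing -/

/-- `x ↦ ∂_e G(x)` is smooth for smooth `G`. [folklore] -/
theorem isSmooth_fderiv_apply {G : 𝕋³ → E³} (hG : IsSmooth G) (e : E³) :
    IsSmooth (fun x => Torus.fderiv G x e) :=
  (isSmooth_const e).convect hG

/-- `x ↦ ⟪u(x), G(x)⟫` is integrable for `u ∈ H` and continuous `G`. [folklore] -/
theorem integrable_inner_coe {G : 𝕋³ → E³} (hG : Continuous G) (u : energySpace (Fin 3)) :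
    Integrable (fun x => ⟪((u : Lp E³ 2 (volume : Measure 𝕋³)) : 𝕋³ → E³) x, G x⟫_ℝ) volume :=
  integrable_inner_of_continuous ((Lp.memLp _).integrable one_le_two) hG

/-- The drift pairing is additive in the drift. [folklore] -/
theorem driftTerm_add (e e' : E³) (Φ : CylindricalTest (Fin 3)) (u : energySpace (Fin 3)) :
    driftTerm (e + e') Φ u = driftTerm e Φ u + driftTerm e' Φ u := by
  unfold driftTerm
  rw [← integral_add
    (integrable_inner_coe (isSmooth_fderiv_apply (CylindricalTest.isSmooth_grad_holds Φ u) e).continuous u)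
    (integrable_inner_coe (isSmooth_fderiv_apply (CylindricalTest.isSmooth_grad_holds Φ u) e').continuous u)]
  refine integral_congr_ae (ae_of_all _ fun x => ?_)
  simp only [map_add, inner_add_right]

/-- `∂_e Φ'(u)(x) = ∑ᵢ ∂ᵢφ(coords u) ∂_e gᵢ(x)`. [folklore] -/
theorem fderiv_grad_apply (Φ : CylindricalTest (Fin 3)) (u : energySpace (Fin 3)) (x : 𝕋³) (e : E³) :
    Torus.fderiv (Φ.grad u) x e =
      ∑ i, _root_.fderiv ℝ Φ.φ (Φ.coords u) (EuclideanSpace.single i 1) • Torus.fderiv (Φ.g i) x e := by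
  rw [Φ.grad_eq_sum_smul u, Literature.Analysis.FluidPDE.Torus.fderiv_sum_smul Finset.univ _
    (fun i _ => Φ.g_smooth i) x]
  simp

/-- `(u, (e·∇)Φ'(u)) = ∑ᵢ ∂ᵢφ(coords u) (u, ∂_e gᵢ)`. [folklore] -/
theorem driftTerm_eq_sum (e : E³) (Φ : CylindricalTest (Fin 3)) (u : energySpace (Fin 3)) :
    driftTerm e Φ u = ∑ i, _root_.fderiv ℝ Φ.φ (Φ.coords u) (EuclideanSpace.single i 1) *
      ∫ x, ⟪((u : Lp E³ 2 (volume : Measure 𝕋³)) : 𝕋³ → E³) x, Torus.fderiv (Φ.g i) x e⟫_ℝ := by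
  unfold driftTerm
  simp_rw [fderiv_grad_apply, inner_sum, inner_smul_right]
  rw [integral_finsetSum _ fun i _ =>
    (integrable_inner_coe (isSmooth_fderiv_apply (Φ.g_smooth i) e).continuous u).const_mul _]
  simp_rw [integral_const_mul]

/-- The drift pairing `u ↦ (u, (e·∇)Φ'(u))` is continuous on `H`. [folklore] -/
theorem continuous_driftTerm (e : E³) (Φ : CylindricalTest (Fin 3)) : Continuous (driftTerm e Φ) := by
  have h : driftTerm e Φ = fun u => ∑ i, _root_.fderiv ℝ Φ.φ (Φ.coords u) (EuclideanSpace.single i 1) *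
      pairing (u : Lp E³ 2 (volume : Measure 𝕋³)) (fun x => Torus.fderiv (Φ.g i) x e) :=
    funext fun u => driftTerm_eq_sum e Φ u
  rw [h]
  exact continuous_finsetSum _ fun i _ =>
    (Φ.continuous_fderiv_coords i).mul
      (continuous_pairing_coe ((isSmooth_fderiv_apply (Φ.g_smooth i) e).memLp 2))

/-- The route integrand is the drift–Euler tested generator plus the drift pairing. [folklore] -/
theorem routeIntegrand_eq (m h : E³) (Φ : CylindricalTest (Fin 3)) (u : energySpace (Fin 3)) :
    routeIntegrand m h Φ u = nsGeneratorPairing 0 fK u (Φ.grad u) + driftTerm (m + h) Φ u := by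
  unfold routeIntegrand nsGeneratorPairing
  ring

/-- The route integrand is continuous on `H`. [folklore] -/
theorem continuous_routeIntegrand (m h : E³) (Φ : CylindricalTest (Fin 3)) :
    Continuous (routeIntegrand m h Φ) := by
  have e : routeIntegrand m h Φ = fun u => nsGeneratorPairing 0 fK u (Φ.grad u) + driftTerm (m + h) Φ u :=
    funext fun u => routeIntegrand_eq m h Φ u
  rw [e]
  exact (continuous_nsGeneratorPairing_grad 0 isSmooth_fK.integrable Φ).add (continuous_driftTerm _ Φ)

/-! ## The integrand along the orbit -/

/-- On the orbit the root identity kills the `m`-part: `I(orb s) = (orb s, (h·∇)Φ'(orb s))`. [folklore] -/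
theorem routeIntegrand_orb (h : E³) (Φ : CylindricalTest (Fin 3)) (s : 𝕋²) :
    routeIntegrand drift h Φ (orb s) = driftTerm h Φ (orb s) := by
  have hr := root_identity_shift s (coe_orb s) (CylindricalTest.isSmooth_grad_holds Φ (orb s))
    (CylindricalTest.isDivFree_grad_holds Φ (orb s))
  unfold routeIntegrand
  rw [driftTerm_add]
  unfold driftTerm inertialPairing at *
  linarith

/-- Pairings of `orb s` are pairings of the translate `v(· + hvec s)`. [folklore] -/
theorem integral_inner_orb (s : 𝕋²) (G : 𝕋³ → E³) :
    ∫ x, ⟪((orb s : Lp E³ 2 (volume : Measure 𝕋³)) : 𝕋³ → E³) x, G x⟫_ℝ =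
      ∫ x, ⟪vfield (x + hvec s), G x⟫_ℝ :=
  integral_congr_ae (by filter_upwards [coe_orb s] with x hx; rw [hx, vshift_apply])

/-! ## Differentiating the coordinates along a horizontal line -/

/-- `v` is `C¹`. [folklore] -/
theorem isContDiff_one_vfield : IsContDiff 1 vfield := isSmooth_vfield.isContDiff (by simp)

/-- The pairing `t ↦ (v(· + a + t e), g)` is differentiable with derivative `(∂_e v(· + a + t e), g)`
(differentiation under the integral sign; `v ∈ C¹`, `g` continuous, `T³` compact). [folklore] -/
theorem hasDerivAt_pairing_line {g : 𝕋³ → E³} (hg : Continuous g) (a : 𝕋³) (e : E³) (t₀ : ℝ) :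
    HasDerivAt (fun t : ℝ => ∫ x, ⟪vfield (x + (a + proj (t • e))), g x⟫_ℝ)
      (∫ x, ⟪Torus.lineDeriv vfield (x + (a + proj (t₀ • e))) e, g x⟫_ℝ) t₀ := by
  have hv1 := isContDiff_one_vfield
  have hcv : Continuous fun y : 𝕋³ => Torus.lineDeriv vfield y e := by
    simp_rw [lineDeriv_eq_fderiv_apply hv1]
    exact hv1.continuous_fderiv.clm_apply continuous_const
  obtain ⟨Cv, hCv⟩ := isCompact_univ.exists_bound_of_continuousOn hcv.continuousOn
  obtain ⟨Cg, hCg⟩ := isCompact_univ.exists_bound_of_continuousOn hg.continuousOn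
  have hCv0 : 0 ≤ Cv := (norm_nonneg _).trans (hCv 0 (mem_univ _))
  set F : ℝ → 𝕋³ → ℝ := fun t x => ⟪vfield (x + (a + proj (t • e))), g x⟫_ℝ with hF
  set F' : ℝ → 𝕋³ → ℝ := fun t x => ⟪Torus.lineDeriv vfield (x + (a + proj (t • e))) e, g x⟫_ℝ with hF'
  have hF_int : ∀ t ∈ (univ : Set ℝ), Integrable (F t) (volume : Measure 𝕋³) := fun t _ =>
    ((isSmooth_vfield.continuous.comp (continuous_add_const (a + proj (t • e)))).inner hg).integrable_unitAddTorus
  have hderiv : ∀ t ∈ (univ : Set ℝ), ∀ x, HasDerivWithinAt (F · x) (F' t x) univ t := by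
    intro t _ x
    have h1 := (hasDerivAt_comp_add_proj_smul hv1 (x + a) e t).inner ℝ (hasDerivAt_const t (g x))
    simp only [inner_zero_right, zero_add, add_assoc] at h1
    exact h1.hasDerivWithinAt
  have hbound : ∀ᶠ t in 𝓝[univ] t₀, ∀ x, ‖F' t x‖ ≤ Cv * Cg :=
    Filter.Eventually.of_forall fun t x => (norm_inner_le_norm _ _).trans
      (mul_le_mul (hCv _ (mem_univ _)) (hCg _ (mem_univ _)) (norm_nonneg _) hCv0)
  have hmeas : AEStronglyMeasurable (F' t₀) (volume : Measure 𝕋³) :=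
    ((hcv.comp (continuous_add_const _)).inner hg).aestronglyMeasurable
  exact (hasDerivWithinAt_integral_of_convex convex_univ (mem_univ t₀) hF_int hderiv hbound
    hmeas).hasDerivAt univ_mem

/-- Integration by parts against a constant (divergence-free) direction:
`(∂_e v(· + a), g) = -(v(· + a), ∂_e g)`. [folklore] -/
theorem integral_inner_lineDeriv_shift {g : 𝕋³ → E³} (hg : IsSmooth g) (a : 𝕋³) (e : E³) :
    ∫ x, ⟪Torus.lineDeriv vfield (x + a) e, g x⟫_ℝ = -∫ x, ⟪vfield (x + a), Torus.fderiv g x e⟫_ℝ := by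
  have h := integral_inner_convect_eq_neg (isSmooth_const e) (isDivFree_const_field e)
    (isSmooth_vshift a) hg
  have e1 : ∀ x, Torus.lineDeriv vfield (x + a) e = Torus.convect (fun _ => e) (vshift a) x := fun x => by
    have hx : Torus.fderiv (vshift a) x = Torus.fderiv vfield (x + a) := fderiv_translate vfield a x
    rw [Torus.convect, hx, lineDeriv_eq_fderiv_apply isContDiff_one_vfield]
  simp_rw [e1, h]
  rfl

/-! ## Horizontal directions -/

/-- The planar shadow `h̄ = (h₀, h₂)` of a horizontal vector `h = (h₀, 0, h₂)`. [folklore] -/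
def hbar (e : E³) : E² := WithLp.toLp 2 ![e 0, e 2]

/-- `⟪h, e₁⟫ = 0` means `h₁ = 0`. [folklore] -/
theorem apply_one_eq_zero_of_inner {h : E³} (hh : ⟪h, EuclideanSpace.single (1 : Fin 3) (1 : ℝ)⟫_ℝ = 0) :
    h 1 = 0 := by
  simpa [EuclideanSpace.inner_single_right] using hh

/-- For horizontal `h`: `hvec (proj (t h̄)) = proj (t h)`. [folklore] -/
theorem hvec_proj_smul_hbar {h : E³} (hh : h 1 = 0) (t : ℝ) : hvec (proj (t • hbar h)) = proj (t • h) := by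
  ext i
  fin_cases i <;> simp [hvec, hbar, hh]

/-! ## The derivative of `Φ ∘ orb` along a horizontal line -/

/-- Along the line `t ↦ s + t h̄` the cylindrical functional `Φ(orb ·)` is differentiable with
derivative `-(orb σ, (h·∇)Φ'(orb σ))`, `σ = s + t h̄` (chain rule + differentiation of the pairings
+ integration by parts). [folklore] -/
theorem hasDerivAt_eval_orb_line (Φ : CylindricalTest (Fin 3)) {h : E³} (hh : h 1 = 0) (s : 𝕋²) (t₀ : ℝ) :
    HasDerivAt (fun t : ℝ => Φ.eval (orb (s + proj (t • hbar h))))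
      (-(driftTerm h Φ (orb (s + proj (t₀ • hbar h))))) t₀ := by
  -- the coordinates along the line, written with the smooth representative
  have hq : ∀ (i : Fin Φ.m) (t : ℝ), pairing ((orb (s + proj (t • hbar h)) : Lp E³ 2 (volume : Measure 𝕋³)))
      (Φ.g i) = ∫ x, ⟪vfield (x + (hvec s + proj (t • h))), Φ.g i x⟫_ℝ := by
    intro i t
    unfold pairing
    rw [integral_inner_orb]
    simp_rw [hvec_add, hvec_proj_smul_hbar hh]
  -- derivative of each coordinate
  have hqi : ∀ i : Fin Φ.m, HasDerivAt
      (fun t : ℝ => pairing ((orb (s + proj (t • hbar h)) : Lp E³ 2 (volume : Measure 𝕋³))) (Φ.g i))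
      (-(∫ x, ⟪vfield (x + hvec (s + proj (t₀ • hbar h))), Torus.fderiv (Φ.g i) x h⟫_ℝ)) t₀ := by
    intro i
    have h1 := hasDerivAt_pairing_line (Φ.g_smooth i).continuous (hvec s) h t₀
    rw [integral_inner_lineDeriv_shift (Φ.g_smooth i), ← hvec_proj_smul_hbar hh, ← hvec_add] at h1
    refine h1.congr_of_eventuallyEq (Filter.Eventually.of_forall fun t => ?_)
    exact hq i t
  -- derivative of the coordinate vector
  have hQ : HasDerivAt (fun t : ℝ => Φ.coords (orb (s + proj (t • hbar h))))
      (WithLp.toLp 2 fun i => -(∫ x, ⟪vfield (x + hvec (s + proj (t₀ • hbar h))),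
        Torus.fderiv (Φ.g i) x h⟫_ℝ)) t₀ := by
    have hpi := hasDerivAt_pi.2 hqi
    have := (PiLp.hasStrictFDerivAt_toLp (𝕜 := ℝ) 2
      (fun i => pairing ((orb (s + proj (t₀ • hbar h)) : Lp E³ 2 (volume : Measure 𝕋³))) (Φ.g i))).hasFDerivAt.comp_hasDerivAt t₀ hpi
    simpa [PiLp.coe_symm_continuousLinearEquiv, Function.comp_def, CylindricalTest.coords] using this
  -- chain rule with `φ ∈ C¹`
  have hφ : HasFDerivAt Φ.φ (_root_.fderiv ℝ Φ.φ (Φ.coords (orb (s + proj (t₀ • hbar h)))))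
      (Φ.coords (orb (s + proj (t₀ • hbar h)))) :=
    ((Φ.φ_contDiff.differentiable one_ne_zero) _).hasFDerivAt
  have hc := hφ.comp_hasDerivAt t₀ hQ
  -- expand the linear map on the derivative vector
  have hexp : _root_.fderiv ℝ Φ.φ (Φ.coords (orb (s + proj (t₀ • hbar h))))
      (WithLp.toLp 2 fun i => -(∫ x, ⟪vfield (x + hvec (s + proj (t₀ • hbar h))),
        Torus.fderiv (Φ.g i) x h⟫_ℝ)) = -(driftTerm h Φ (orb (s + proj (t₀ • hbar h)))) := by
    rw [eq_sum_coord_smul_single (WithLp.toLp 2 fun i => -(∫ x, ⟪vfield (x + hvec (s + proj (t₀ • hbar h))),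
        Torus.fderiv (Φ.g i) x h⟫_ℝ)), map_sum]
    simp only [map_smul, smul_eq_mul]
    rw [driftTerm_eq_sum, ← Finset.sum_neg_distrib]
    refine Finset.sum_congr rfl fun i _ => ?_
    rw [integral_inner_orb]
    ring
  rw [hexp] at hc
  exact hc

/-! ## Vanishing of the orbit average of the drift pairing -/

/-- `s ↦ Φ(orb s)` is continuous. [folklore] -/
theorem continuous_eval_orb (Φ : CylindricalTest (Fin 3)) : Continuous fun s : 𝕋² => Φ.eval (orb s) :=
  (Φ.φ_contDiff.continuous.comp Φ.continuous_coords).comp continuous_orb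

/-- The drift pairing is bounded along the orbit (indeed on all of the orbit's compact range). [folklore] -/
theorem exists_bound_driftTerm_orb (e : E³) (Φ : CylindricalTest (Fin 3)) :
    ∃ C : ℝ, ∀ s : 𝕋², ‖driftTerm e Φ (orb s)‖ ≤ C := by
  obtain ⟨C, hC⟩ := isCompact_univ.exists_bound_of_continuousOn
    ((continuous_driftTerm e Φ).comp continuous_orb).continuousOn
  exact ⟨C, fun s => hC s (mem_univ _)⟩

/-- **The orbit average of the drift pairing vanishes**: `∫_{T²} (orb s, (h·∇)Φ'(orb s)) ds = 0` for
horizontal `h` — it is minus the `t`-derivative at `0` of the constant `∫_{T²} Φ(orb(s + t h̄)) ds`. [folklore] -/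
theorem integral_driftTerm_orb_eq_zero (Φ : CylindricalTest (Fin 3)) {h : E³} (hh : h 1 = 0) :
    ∫ s, driftTerm h Φ (orb s) ∂(volume : Measure 𝕋²) = 0 := by
  obtain ⟨C, hC⟩ := exists_bound_driftTerm_orb h Φ
  -- derivative of the (constant) orbit average
  have key := hasDerivWithinAt_integral_of_convex (μ := (volume : Measure 𝕋²)) convex_univ (mem_univ (0 : ℝ))
    (F := fun t s => Φ.eval (orb (s + proj (t • hbar h))))
    (F' := fun t s => -(driftTerm h Φ (orb (s + proj (t • hbar h)))))
    (fun t _ => ((continuous_eval_orb Φ).comp (continuous_add_const _)).integrable_unitAddTorus)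
    (fun t _ s => (hasDerivAt_eval_orb_line Φ hh s t).hasDerivWithinAt)
    (C := C)
    (Filter.Eventually.of_forall fun t s => by rw [norm_neg]; exact hC _)
    ((((continuous_driftTerm h Φ).comp continuous_orb).comp (continuous_add_const _)).neg.aestronglyMeasurable)
  have hconst : (fun t : ℝ => ∫ s, Φ.eval (orb (s + proj (t • hbar h))) ∂(volume : Measure 𝕋²)) =
      fun _ => ∫ s, Φ.eval (orb s) ∂(volume : Measure 𝕋²) := by
    funext t
    exact integral_add_right_eq_self (μ := (volume : Measure 𝕋²)) (fun s => Φ.eval (orb s)) _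
  rw [hconst] at key
  have h0 := (key.hasDerivAt univ_mem).unique (hasDerivAt_const (0 : ℝ) _)
  simp only [zero_smul] at h0
  have h1 : ∫ s, -(driftTerm h Φ (orb (s + proj 0))) ∂(volume : Measure 𝕋²) =
      -∫ s, driftTerm h Φ (orb s) ∂(volume : Measure 𝕋²) := by
    rw [integral_neg]
    congr 1
    refine integral_congr_ae (ae_of_all _ fun s => ?_)
    simp
  rw [h1] at h0
  exact neg_eq_zero.1 h0

/-! ## The orbit climate is an invariant climate of the route -/

/-- **Stationarity of the orbit climate**: for horizontal `h` and every cylindrical `Φ`,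
`∫ I_{m,h,Φ} dμ = 0`. [folklore] -/
theorem integral_routeIntegrand_orbMeasure {h : E³}
    (hh : ⟪h, EuclideanSpace.single (1 : Fin 3) (1 : ℝ)⟫_ℝ = 0) (Φ : CylindricalTest (Fin 3)) :
    ∫ v, routeIntegrand drift h Φ v ∂orbMeasure = 0 := by
  rw [orbMeasure, integral_map measurable_orb.aemeasurable
    (continuous_routeIntegrand drift h Φ).aestronglyMeasurable]
  simp_rw [routeIntegrand_orb]
  exact integral_driftTerm_orb_eq_zero Φ (apply_one_eq_zero_of_inner hh)

/-- **The orbit climate belongs to the route's invariant-climate class `C̄(c_K e₁, R₀)`.** [folklore] -/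
theorem orbMeasure_mem_climateClass : orbMeasure ∈ climateClass drift R0 :=
  ⟨inferInstance, ae_eGradNormSq_le, fun _ hh Φ => integral_routeIntegrand_orbMeasure hh Φ⟩

end Summit.AnomalousDissipation.AnomalousDissipation.Theorems.CrossedShearOrbit

end
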